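import Mathlib
import Literature.Computability.AlgebraicComplexity.StandardFamilies
import Literature.Computability.AlgebraicComplexity.PowerSumNonvanishing
import Summits.ValiantsHypothesis.ValiantsHypothesis.Theses.RefutationDegree
import Summits.ValiantsHypothesis.ValiantsHypothesis.Theorems.RefutationDegreeDefs

/-!
# Crux `RefutationBarrier` (stmt-ValiantsHypothesis-5642), line `Sketch-ideator1`:
# stub T0 `stub_sosPaddingMono` (padding monotonicity)

A degree-`D` Hermitian-SOS refutation of Rep(n,m+1) restricts along the padding `A ↦ A ⊕ [1]` to a
degree-`D` Hermitian-SOS refutation of Rep(n,m) (`stub_sosPaddingMono`, iterated by the lead in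
`hasSosRef_anti`).  The restriction is the `ℂ`-algebra map `φ = aeval s₂` on the doubled unknowns
`(a, ā)`, where `s₂` applies in each copy the one-copy substitution `s` sending the corner unknown
`(none,(0,0))` of `A₀` to `1`, every other unknown of row `0` or column `0` to `0`, and the unknown
`(t,(i+1,j+1))` of size `m+1` to the unknown `(t,(i,j))` of size `m` (padding at index `0`, so that
`Matrix.det_succ_row_zero` applies; `exists_padSub`).  The restriction theorem `hasSosRef_restrict`
is proved for ANY one-copy substitution `s` with (i) real values (`map conj (s u) = s u`),
(ii) values of total degree `≤ 1`, (iii) `map (aeval s) (det A^{(m+1)}(x)) = det A^{(m)}(x)`, and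
any two-copy substitution `s₂` with `s₂ (inl u) = rename inl (s u)` and
`s₂ (inr u) = rename inr (s u)`:
* (i) gives `φ ∘ cj = cj ∘ φ` (`aeval_two_cj`);
* (iii) and `aeval s ∘ C = C` give `φ (eqn^{(m+1)}_μ) = eqn^{(m)}_μ` (`aeval_two_eqn`) and
  `supp P^{(m)} ⊆ supp P^{(m+1)}`;
* (ii) gives that `φ` does not raise total degrees (`totalDegree_aeval_le_of_forall_le_one`);
* applying the ring map `φ` to the size-`(m+1)` identity gives the size-`m` identity with witnesses
  `φ ∘ q`, `φ ∘ h`, the sum over `supp P^{(m+1)}` collapsing to `supp P^{(m)}` because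
  `eqn^{(m)}_μ = 0` off `supp P^{(m)}`.
For the padding substitution, (i) and (ii) hold because its values are `0`, `1` or a variable, and
(iii) because the padded generic pencil has row `0` equal to `(1, 0, …, 0)` and lower-right block
`A^{(m)}(x)` (Laplace expansion along row `0`).  No auxiliary definition is introduced: the
substitutions are universally quantified variables, the padding substitution an explicit witness.

References: standard (padding of determinantal expressions, e.g. Mignon–Ressayre 2004, §2;
Grigoriev 2001 for the Positivstellensatz format).  Not here: the other stubs of the line (T1, C⁺,
NsToSos, T2).

Vocabulary (`Unk`, `pencil`, `defect`, `eqn`, `cj`, `HasSosRef`):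
`Theorems/RefutationDegreeDefs.lean`.
-/

-- `Summit.ValiantsHypothesis.ValiantsHypothesis.…` is the tree's mandated single-conjunct layout
-- (Sub = Summit), so the duplicated namespace component is intended.
set_option linter.dupNamespace false

noncomputable section

namespace Summit.ValiantsHypothesis.ValiantsHypothesis.Theorems.RefutationDegree

open scoped BigOperators
open Filter Topology MvPolynomial
open Literature.Computability.AlgebraicComplexity (perPoly)
open Summit.ValiantsHypothesis.ValiantsHypothesis.Theses.RefutationDegree

/-! ## Doubling a real substitution of degree `≤ 1` to the two copies `(a, ā)` -/

section Double

/-- `Sum.swap ∘ Sum.inl = Sum.inr`. [folklore] -/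
private theorem swap_comp_inl {α β : Type*} : (Sum.swap ∘ Sum.inl : α → β ⊕ α) = Sum.inr := rfl

/-- `Sum.swap ∘ Sum.inr = Sum.inl`. [folklore] -/
private theorem swap_comp_inr {α β : Type*} : (Sum.swap ∘ Sum.inr : β → β ⊕ α) = Sum.inl := rfl

variable {σ τ : Type*} (s : σ → MvPolynomial τ ℂ) (s₂ : σ ⊕ σ → MvPolynomial (τ ⊕ τ) ℂ)
  (hl : ∀ u, s₂ (Sum.inl u) = rename Sum.inl (s u))
  (hr : ∀ u, s₂ (Sum.inr u) = rename Sum.inr (s u))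
include hl

/-- `aeval s₂ ∘ rename inl = rename inl ∘ aeval s`. [folklore] -/
private theorem aeval_two_rename_inl (p : MvPolynomial σ ℂ) :
    aeval s₂ (rename Sum.inl p) = rename Sum.inl (aeval (R := ℂ) s p) := by
  rw [aeval_rename, comp_aeval_apply, show s₂ ∘ Sum.inl = fun u => rename Sum.inl (s u) from
    funext hl]

include hr

/-- For a REAL substitution (`map conj ∘ s = s`), `aeval s₂` on a variable of the swapped copy is
the conjugate-swap of its value on the variable. [folklore] -/
private theorem aeval_two_X_swap (hs : ∀ u, MvPolynomial.map (starRingEnd ℂ) (s u) = s u)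
    (v : σ ⊕ σ) :
    aeval s₂ (X (Sum.swap v) : MvPolynomial (σ ⊕ σ) ℂ) =
      rename Sum.swap (MvPolynomial.map (starRingEnd ℂ)
        (aeval s₂ (X v : MvPolynomial (σ ⊕ σ) ℂ))) := by
  cases v with
  | inl u =>
      simp only [Sum.swap_inl, aeval_X, hl, hr, map_rename, hs, rename_rename, swap_comp_inl]
  | inr u =>
      simp only [Sum.swap_inr, aeval_X, hl, hr, map_rename, hs, rename_rename, swap_comp_inr]

/-- **For a real substitution, `aeval s₂` commutes with the conjugation `cj`.** [folklore] -/
private theorem aeval_two_cj (hs : ∀ u, MvPolynomial.map (starRingEnd ℂ) (s u) = s u)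
    (p : MvPolynomial (σ ⊕ σ) ℂ) :
    aeval s₂ (cj σ p) = cj τ (aeval s₂ p) := by
  induction p using MvPolynomial.induction_on with
  | C a => simp only [cj, map_C, algHom_C, algebraMap_eq]
  | add p q hp hq =>
      simp only [cj, map_add] at hp hq ⊢
      rw [hp, hq]
  | mul_X p v hp =>
      simp only [cj, map_mul, map_X, rename_X] at hp ⊢
      rw [hp, aeval_two_X_swap s s₂ hl hr hs]

/-- **For a substitution with values of total degree `≤ 1`, `aeval s₂` does not raise total
degrees.** [folklore] -/
private theorem totalDegree_aeval_two_le (hd : ∀ u, (s u).totalDegree ≤ 1)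
    (p : MvPolynomial (σ ⊕ σ) ℂ) : (aeval s₂ p).totalDegree ≤ p.totalDegree :=
  Literature.Computability.AlgebraicComplexity.totalDegree_aeval_le_of_forall_le_one s₂
    (fun v => by
      cases v with
      | inl u => rw [hl]; exact (totalDegree_rename_le _ _).trans (hd u)
      | inr u => rw [hr]; exact (totalDegree_rename_le _ _).trans (hd u))
    p

end Double

/-! ## Restricting a refutation of Rep(n,m+1) along a substitution `a^{(m+1)} ↦ s(a^{(m)})` -/

section Restrict

variable (n m : ℕ) (s : Unk n (m + 1) → MvPolynomial (Unk n m) ℂ)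

/-- A substitution fixes the constants: `aeval s ∘ C = C` as ring maps. [folklore] -/
private theorem aeval_comp_C :
    (RingHomClass.toRingHom (aeval (R := ℂ) s)).comp C = C :=
  RingHom.ext fun c => by
    simp only [RingHom.comp_apply, RingHom.coe_coe, algHom_C, algebraMap_eq]

variable (hdet : MvPolynomial.map (aeval (R := ℂ) s) (pencil n (m + 1)).det = (pencil n m).det)
include hdet

/-- If `s` maps `det A^{(m+1)}(x)` to `det A^{(m)}(x)` (coefficientwise in `x`), it maps the defect
`P^{(m+1)}` to `P^{(m)}` (the permanent term is constant in the unknowns). [folklore] -/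
private theorem map_aeval_defect :
    MvPolynomial.map (aeval (R := ℂ) s) (defect n (m + 1)) = defect n m := by
  rw [defect, defect, map_sub, hdet, MvPolynomial.map_map, aeval_comp_C]

/-- … hence the equations: `aeval s (P^{(m+1)}.coeff μ) = P^{(m)}.coeff μ`. [folklore] -/
private theorem aeval_coeff_defect (μ : (Fin n × Fin n) →₀ ℕ) :
    aeval (R := ℂ) s ((defect n (m + 1)).coeff μ) = (defect n m).coeff μ := by
  rw [← map_aeval_defect n m s hdet, coeff_map, RingHom.coe_coe]

/-- … hence the supports: `supp P^{(m)} ⊆ supp P^{(m+1)}`. [folklore] -/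
private theorem support_defect_subset_of : (defect n m).support ⊆ (defect n (m + 1)).support := by
  intro μ hμ
  rw [mem_support_iff] at hμ ⊢
  intro h0
  apply hμ
  rw [← aeval_coeff_defect n m s hdet, h0, map_zero]

variable (s₂ : Unk n (m + 1) ⊕ Unk n (m + 1) → MvPolynomial (Unk n m ⊕ Unk n m) ℂ)
  (hl : ∀ u, s₂ (Sum.inl u) = rename Sum.inl (s u))
include hl

/-- … hence the holomorphic copies: `aeval s₂ (eqn^{(m+1)}_μ) = eqn^{(m)}_μ`. [folklore] -/
private theorem aeval_two_eqn (μ : (Fin n × Fin n) →₀ ℕ) :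
    aeval s₂ (eqn n (m + 1) μ) = eqn n m μ := by
  simp only [eqn, aeval_two_rename_inl s s₂ hl, aeval_coeff_defect n m s hdet]

variable (hr : ∀ u, s₂ (Sum.inr u) = rename Sum.inr (s u))
  (hs : ∀ u, MvPolynomial.map (starRingEnd ℂ) (s u) = s u) (hd : ∀ u, (s u).totalDegree ≤ 1)
include hr hs hd

/-- **Restriction of Hermitian-SOS refutations along a substitution.** If `s` is real, has values of
total degree `≤ 1` and maps `det A^{(m+1)}(x)` to `det A^{(m)}(x)`, then applying the ring map
`φ = aeval s₂` to a degree-`D` refutation of Rep(n,m+1) gives a degree-`D` refutation of Rep(n,m)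
with witnesses `φ ∘ q`, `φ ∘ h`. [folklore] -/
private theorem hasSosRef_restrict {D : ℕ} : HasSosRef n (m + 1) D → HasSosRef n m D := by
  rintro ⟨k, q, h, hq, hh, hsum⟩
  refine ⟨k, fun i => aeval s₂ (q i), fun μ => aeval s₂ (h μ), fun i => ?_, fun μ => ?_, ?_⟩
  · show (aeval s₂ (q i) * cj (Unk n m) (aeval s₂ (q i))).totalDegree ≤ D
    rw [← aeval_two_cj s s₂ hl hr hs, ← map_mul]
    exact (totalDegree_aeval_two_le s s₂ hl hr hd _).trans (hq i)
  · show (aeval s₂ (h μ) * eqn n m μ).totalDegree ≤ D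
    rw [← aeval_two_eqn n m s hdet s₂ hl, ← map_mul]
    exact (totalDegree_aeval_two_le s s₂ hl hr hd _).trans (hh μ)
  · show ∑ i, aeval s₂ (q i) * cj (Unk n m) (aeval s₂ (q i)) +
        ∑ μ ∈ (defect n m).support,
          (aeval s₂ (h μ) * eqn n m μ + cj (Unk n m) (aeval s₂ (h μ) * eqn n m μ)) + 1 = 0
    have key := congrArg (aeval s₂) hsum
    simp only [map_add, map_sum, map_mul, map_one, map_zero, aeval_two_cj s s₂ hl hr hs,
      aeval_two_eqn n m s hdet s₂ hl] at key
    have hS : ∑ μ ∈ (defect n m).support,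
          (aeval s₂ (h μ) * eqn n m μ + cj (Unk n m) (aeval s₂ (h μ) * eqn n m μ)) =
        ∑ μ ∈ (defect n (m + 1)).support,
          (aeval s₂ (h μ) * eqn n m μ + cj (Unk n m) (aeval s₂ (h μ) * eqn n m μ)) := by
      refine Finset.sum_subset (support_defect_subset_of n m s hdet) fun μ _ hμ => ?_
      rw [notMem_support_iff] at hμ
      simp only [eqn, hμ, map_zero, mul_zero, cj, zero_add]
    rw [hS]
    exact key

end Restrict

/-! ## The padding substitution `A ↦ A ⊕ [1]` -/

/-- **The padding substitution.** There is a one-copy substitution of the unknowns of size `m+1` by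
polynomials in the unknowns of size `m` which is real, has values of total degree `≤ 1`, and maps
`det A^{(m+1)}(x)` to `det A^{(m)}(x)`: the unknown `(t,(i+1,j+1))` goes to the unknown `(t,(i,j))`,
the corner unknown `(none,(0,0))` of `A₀` to `1`, every other unknown of row `0` or column `0` (the
corners of the `A_e` included) to `0`; the padded generic pencil then has row `0` equal to
`(1, 0, …, 0)` and lower-right block `A^{(m)}(x)` (Laplace expansion along row `0`). [folklore] -/
theorem exists_padSub (n m : ℕ) :
    ∃ s : Unk n (m + 1) → MvPolynomial (Unk n m) ℂ,
      (∀ u, MvPolynomial.map (starRingEnd ℂ) (s u) = s u) ∧ (∀ u, (s u).totalDegree ≤ 1) ∧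
        MvPolynomial.map (aeval (R := ℂ) s) (pencil n (m + 1)).det = (pencil n m).det := by
  refine ⟨fun u =>
    Fin.cases (motive := fun _ => MvPolynomial (Unk n m) ℂ)
      (Fin.cases (motive := fun _ => MvPolynomial (Unk n m) ℂ) (u.1.elim 1 fun _ => 0) (fun _ => 0)
        u.2.2)
      (fun i => Fin.cases (motive := fun _ => MvPolynomial (Unk n m) ℂ) 0 (fun j => X (u.1, (i, j)))
        u.2.2)
      u.2.1, ?_, ?_, ?_⟩
  · -- real values: `0`, `1` or a variable
    rintro ⟨t, i, j⟩
    refine Fin.cases ?_ (fun i' => ?_) i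
    · refine Fin.cases ?_ (fun _ => map_zero _) j
      cases t with
      | none => exact map_one _
      | some _ => exact map_zero _
    · exact Fin.cases (map_zero _) (fun j' => map_X _ (t, (i', j'))) j
  · -- values of total degree `≤ 1`
    rintro ⟨t, i, j⟩
    refine Fin.cases ?_ (fun i' => ?_) i
    · refine Fin.cases ?_ (fun _ => totalDegree_zero.le.trans zero_le_one) j
      cases t with
      | none => exact totalDegree_one.le.trans zero_le_one
      | some _ => exact totalDegree_zero.le.trans zero_le_one
    · exact Fin.cases (totalDegree_zero.le.trans zero_le_one)
        (fun j' => (totalDegree_X (R := ℂ) ((t, (i', j')) : Unk n m)).le) j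
  · -- the determinant: Laplace expansion of the padded pencil along row `0`
    rw [RingHom.map_det, Matrix.det_succ_row_zero, Fin.sum_univ_succ]
    simp only [RingHom.mapMatrix_apply, Matrix.map_apply, pencil, Matrix.of_apply, map_add, map_sum,
      map_mul, map_C, map_X, RingHom.coe_coe, aeval_X, Fin.cases_zero, Fin.cases_succ,
      Option.elim_none, Option.elim_some, C_1, C_0, mul_zero, zero_mul, Finset.sum_const_zero,
      add_zero, Fin.val_zero, pow_zero, one_mul, Fin.succAbove_zero]
    congr 1
    ext i j
    simp only [Matrix.submatrix_apply, Matrix.map_apply, Matrix.of_apply, map_add, map_sum, map_mul,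
      map_C, map_X, RingHom.coe_coe, aeval_X, Fin.cases_succ]

/-- The support of `P^{(m)}` is contained in the support of `P^{(m+1)}`. [folklore] -/
theorem support_defect_subset_succ (n m : ℕ) :
    (defect n m).support ⊆ (defect n (m + 1)).support := by
  obtain ⟨s, -, -, hdet⟩ := exists_padSub n m
  exact support_defect_subset_of n m s hdet

/-! ## Stub T0 -/

/-- **STUB T0 (padding monotonicity).** A degree-`D` Hermitian-SOS refutation of Rep(n,m+1)
restricts along `A ↦ A ⊕ [1]` to a degree-`D` Hermitian-SOS refutation of Rep(n,m): apply the
two-copy padding map `φ` (a ring map commuting with `cj`, not raising total degrees, with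
`φ (eqn^{(m+1)}_μ) = eqn^{(m)}_μ`) to the identity; the new witnesses are `φ ∘ q` and `φ ∘ h`.
[folklore] -/
theorem stub_sosPaddingMono (n m D : ℕ) : HasSosRef n (m + 1) D → HasSosRef n m D := by
  obtain ⟨s, hs, hd, hdet⟩ := exists_padSub n m
  exact hasSosRef_restrict n m s hdet
    (Sum.elim (fun u => rename Sum.inl (s u)) fun u => rename Sum.inr (s u))
    (fun _ => rfl) (fun _ => rfl) hs hd

end Summit.ValiantsHypothesis.ValiantsHypothesis.Theorems.RefutationDegree

end
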